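import Summits.QuantumFields.YangMills.Theorems.UnitScaleTiltHalvingDbarStairUnitary
import Summits.QuantumFields.YangMills.Theorems.UnitScaleTiltHalvingCombTorusTowerOfStep
import HarnessLib

/-!
# Line H (`BirthV10.stub_halvingStep`, stmt-QuantumFields-19200) — (M2′) (b)-row toolbox, brick (B-al-4)₃: ★★★ THE TWO FIELD-SIDE ROWS (F-h) AND (F-hU) FROM THE SOCKET
# GUARDS ALONE — the knit of ✓`HalvingDbarStairSizes` ∕ ✓`HalvingDbarStairUnitary` over LEMMA B-al-2 AT EVERY LEVEL with the step DISCHARGED and the constants PINNED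
# (px15 g4 ✓`HalvingCombTorusTowerOfStep.comb_eq_dbar_mul_defect_levels_inAx`, over px3 g5 ✓`…CombTorusTowerLevels` and ★w3 g10's one-step bricks)

Cell `ym3-torus` (HUMAN RULING D-0037: YM₃ on T³ is ladder rung R3 — NOT d = 4, NOT infinite volume, NOT a mass gap, NOT the Clay problem), width seat `ym-ust-19200-w3`
gen 11 (B-al lineage).  `--supports stmt-QuantumFields-19200 --as helper`; THEOREMS ONLY (0 `def`, 0 `sorry`); count-neutral; nothing here claims (B-al-4)₃'s core `hG_of_rows`,
the (b)-row, (M2′), the stub, the crux or the gap.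

WHAT IS PROVED (namespace `…Theorems.HalvingDbarStairRowsOfGuards`; member `(F, n, K)`, `k = K − n`, `X̂ := unitsField (toUField (gJ•U))`, `U′ := pull X̂ 0`, `ℓ = (d+2)L`,
`c₁ = C₂(d) + 40000(d+2)²`, `δc = (2dL+1)(d(L−1)+L)`, `r⋆ = 240c₁δc²ε₀²`, `r_j = r⋆·(Lʲ)⁴(Lᵏ)⁻⁴`, `p_j = 4ε₀(Lʲ)²(Lᵏ)⁻²`):
* `level_ratio_pow_four_le_one` (`(Lʲ)⁴(Lᵏ)⁻⁴ ≤ 1`, `j ≤ k`), `rs_le_of_hw1` (the tower's window `hw1` ⇒ `r⋆ ≤ 1∕200`).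
* ★★★ `stairSizes_of_guards_inAx` — ROW (F-h) ∕ the skeleton `hG_of_rows`' `hStair`, GLOBAL in the coarse site, from the socket guards `InAk … univ U′` + the `InAx` family, the
  Prop.-2 ∕ (B-iv) ∕ `33A ≤ 20L⁴` windows of ✓`comb_eq_dbar_mul_defect_levels_inAx` and the two stair windows `d(L−1)·4ε₀ ≤ 1∕200`, `4ℓ(d(L−1)·4ε₀ + (102∕100)r⋆) ≤ 1`:
  `∀ j < k, ∀ y idx, ‖U̿^{(j)}X̂(Γ_idx(y)) − 1‖ ≤ hh_j := 4ℓ·(d(L−1)·p_j + (102∕100)·r_j)` — GEOMETRIC (`∝ L^{2(j−k)}`), k-UNIFORM, NO displayed analytic row left.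
* ★★★ `stairUnitary_of_guards_inAx` — ROW (F-hU) ∕ `hStairU` on the label boxes `[tlo L lo ·, thi L hi ·]` of the door's tower row (guard (d), `lo hi` abstract: the door reads
  `tLo a ρ′`, `tHi a M′ ρ′`), windows `s ≤ 1∕200`, `12ℓ(s + (102∕100)r⋆) ≤ 1`: the centre stairs are unitary matrices; ★★★ `stairUnitary_of_guards_inAx_sq` — the same on the skeleton's `sqLo∕sqHi` boxes at `(K−n, K−n)` with the tower row on
  `tLo a ρ′ ∕ tHi a M′ ρ′` (TOKEN FOR TOKEN the row `hStairU`; `tLo_le_sqLo_top`, `sqHi_top_le_tHi`).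
HONEST SCOPE.  `exact`-level knits; the analysis is in the imported files (one-step bricks ★w3 g10, STEP px15 g4, TOWER px3 g5, stairs∕unitarity this seat).  The scalar windows are
displayed for the v10 pack.  Nothing of Prop. 3∕4, Theorem 4, (M2′) or the stub is proved here.

References: T. Bałaban, CMP **98** (1985) 17–51 [Balaban1985Averaging] ((42)–(43) pp.23–24, pp.24–25, (89) p.31, (110) p.34, (127) p.36, Prop. 4 (134)–(135) pp.38–39);
CMP **109** (1987) 249–301 [Balaban1987RG1] ((0.1)–(0.4), (0.9) pp.251–253); CMP **99** (1985) 75–102 [Balaban1985RegularSpaces] ((1.19)–(1.20) p.79, (1.30) p.81).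
-/

set_option autoImplicit false

noncomputable section

open scoped BigOperators Matrix.Norms.L2Operator
open NormedSpace

namespace Summit.QuantumFields.YangMills.Theorems.HalvingDbarStairRowsOfGuards

open Literature.MathematicalPhysics.QuantumFieldTheory.Balaban1983to89
open Literature.MathematicalPhysics.QuantumFieldTheory.Balaban1983to89.T3ContinuumYM3Torus
open T4Continuum BlockAveraging
open Node00 (coverAt)
open B7Prop1Explicit renaming Site → LSite
open B7Prop1Explicit (e)
open B7Prop1Local (InBox)
open B7Prop2Explicit (avgIter C0 c2')
open B7Prop4Flat (C2 c4 C1_pos)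
open B8Ineq130 (tlo thi)
open B8Eq131Cubes (sqLo sqHi tLo tHi gs bLo bHi)
open B8Ineq132 (InAk)
open B8Eq119TwistedAxial (InAx)
open B10Eq27TorusAxialLog (holT pull unitsField toUField)
open Summit.QuantumFields.YangMills.Theorems.Prop8ChartDoubleBar (dbarIterU)
open HalvingCombTorusTowerOfStep (comb_eq_dbar_mul_defect_levels_inAx)
open HalvingDbarStairSizes (stairSizes_of_levelDefect_inAx)
open HalvingDbarStairUnitary (stairUnitary_of_levelDefect inBox_tlo_thi_mono)

variable (F : T3Family) {n K : ℕ}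

/-- `(Lʲ)⁴(Lᵏ)⁻⁴ ≤ 1` for `j ≤ k`, `L ≥ 1`. [cite: Balaban1985Averaging, Prop. 4 (134) p.38] (arithmetic) -/
theorem level_ratio_pow_four_le_one {L : ℝ} (hL : 1 ≤ L) {j k : ℕ} (hjk : j ≤ k) : (L ^ j) ^ 4 * ((L ^ k)⁻¹) ^ 4 ≤ 1 := by
  have hL0 : 0 < L := by linarith
  rw [← mul_pow, ← div_eq_mul_inv]
  have h1 : L ^ j / L ^ k ≤ 1 := (div_le_one (pow_pos hL0 k)).mpr (pow_le_pow_right₀ hL hjk)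
  have h0 : 0 ≤ L ^ j / L ^ k := by positivity
  exact pow_le_one₀ h0 h1

/-- The tower's top-level window `10⁴·ℓ·(δc·4ε₀ + 2·240c₁δc²ε₀²) ≤ 1` (`ℓ ≥ 1`) gives the stair window `240c₁δc²ε₀² ≤ 1∕200`. [folklore] -/
theorem rs_le_of_hw1 {ℓ δc ε₀ c₁ : ℝ} (hℓ : 1 ≤ ℓ) (hδc : 0 ≤ δc) (hε₀ : 0 ≤ ε₀) (hc₁ : 0 ≤ c₁)
    (hw1 : 10 ^ 4 * ℓ * (δc * (4 * ε₀) + 2 * (240 * c₁ * δc ^ 2 * ε₀ ^ 2)) ≤ 1) : 240 * c₁ * δc ^ 2 * ε₀ ^ 2 ≤ 1 / 200 := by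
  have h0 : 0 ≤ δc * (4 * ε₀) := by positivity
  have h1 : 0 ≤ 240 * c₁ * δc ^ 2 * ε₀ ^ 2 := by positivity
  nlinarith [mul_le_mul_of_nonneg_right hℓ h1]

/-- ★★★ **ROW (F-h) ∕ `hStair` FROM THE SOCKET GUARDS** — the centre stairs of `U̿^{(j)}X̂` over every coarse site are within
`4ℓ·(d(L−1)·4ε₀(Lʲ)²(Lᵏ)⁻² + (102∕100)·240c₁δc²ε₀²·(Lʲ)⁴(Lᵏ)⁻⁴)` of `1`, `j < k` (✓`stairSizes_of_levelDefect_inAx` ∘ ✓`comb_eq_dbar_mul_defect_levels_inAx`).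
[cite: Balaban1985Averaging, pp.24-25, (89) p.31, (110) p.34, (127) p.36, Prop. 4 (134)-(135) pp.38-39; Balaban1987RG1, (0.1)-(0.4) pp.251-253; Balaban1985RegularSpaces, (1.19) p.79] -/
theorem stairSizes_of_guards_inAx (hnK : n < K) {ε₀ : ℝ} (hε₀ : 0 < ε₀)
    (hα3 : C0 (F.P K).d * (2 * ε₀) ≤ 1 / 3) (hα2 : 2 * (2 * ε₀) ≤ c2' (F.P K).d (F.P K).L)
    (hw1 : 10 ^ 4 * ((((F.P K).d + 2) * (F.P K).L : ℕ) : ℝ) *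
      ((((2 * ((F.P K).d * (F.P K).L) + 1) * ((F.P K).d * ((F.P K).L - 1) + (F.P K).L) : ℕ) : ℝ) * (4 * ε₀) +
        2 * (240 * (C2 (F.P K).d + 40000 * (((F.P K).d : ℝ) + 2) ^ 2) *
          (((2 * ((F.P K).d * (F.P K).L) + 1) * ((F.P K).d * ((F.P K).L - 1) + (F.P K).L) : ℕ) : ℝ) ^ 2 * ε₀ ^ 2)) ≤ 1)
    (hw2 : ((F.P K).L : ℝ) * (2 * ((((2 * ((F.P K).d * (F.P K).L) + 1) * ((F.P K).d * ((F.P K).L - 1) + (F.P K).L) : ℕ) : ℝ) * (4 * ε₀))) ≤ c4 (F.P K).d)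
    (hA : 33 * (2 * (((((F.P K).d + 2) * (F.P K).L : ℕ) : ℝ) + (F.P K).L + 2 * (((F.P K).d * (((F.P K).L - 1) / 2) : ℕ) : ℝ))) ≤ 20 * ((F.P K).L : ℝ) ^ 4)
    (hpw : (((F.P K).d * ((F.P K).L - 1) : ℕ) : ℝ) * (4 * ε₀) ≤ 1 / 200)
    (hℓw : 4 * ((((F.P K).d + 2) * (F.P K).L : ℕ) : ℝ) * ((((F.P K).d * ((F.P K).L - 1) : ℕ) : ℝ) * (4 * ε₀) +
      102 / 100 * (240 * (C2 (F.P K).d + 40000 * (((F.P K).d : ℝ) + 2) ^ 2) *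
        (((2 * ((F.P K).d * (F.P K).L) + 1) * ((F.P K).d * ((F.P K).L - 1) + (F.P K).L) : ℕ) : ℝ) ^ 2 * ε₀ ^ 2)) ≤ 1)
    (U : GaugeField (F.P K) 0 (Matrix.specialUnitaryGroup (Fin 2) ℂ)) (gJ : GaugeTransf (F.P K) 0 (Matrix.specialUnitaryGroup (Fin 2) ℂ))
    (hInAk : InAk (F.P K).L (K - n) (((F.L : ℝ)⁻¹) ^ (K - n)) ε₀ (fun _ => (Set.univ : Set (LSite (F.P K).d)))
      (pull (unitsField (toUField (GaugeField.gaugeAct gJ U))) 0))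
    (hInAx : ∀ m, m ≤ K - n → ∀ Λ : ℕ → Set (LSite (F.P K).d),
      InAx (F.P K).L m Λ (1 : LSite (F.P K).d → Fin (F.P K).d → (Matrix (Fin 2) (Fin 2) ℂ)ˣ) (pull (unitsField (toUField (GaugeField.gaugeAct gJ U))) 0)) :
    ∀ j, j < K - n → ∀ (y : Site (F.P K) (j + 1)) (i : Idx (F.P K)),
      ‖((holT (dbarIterU j (unitsField (toUField (GaugeField.gaugeAct gJ U)))) (emb y) (stairWord i.2.1 (off i.1)) : (Matrix (Fin 2) (Fin 2) ℂ)ˣ) :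
          Matrix (Fin 2) (Fin 2) ℂ) - 1‖ ≤
        4 * ((((F.P K).d + 2) * (F.P K).L : ℕ) : ℝ) *
          ((((F.P K).d * ((F.P K).L - 1) : ℕ) : ℝ) * (4 * ε₀ * (((F.P K).L : ℝ) ^ j) ^ 2 * ((((F.P K).L : ℝ) ^ (K - n))⁻¹) ^ 2) +
            102 / 100 * (240 * (C2 (F.P K).d + 40000 * (((F.P K).d : ℝ) + 2) ^ 2) *
              (((2 * ((F.P K).d * (F.P K).L) + 1) * ((F.P K).d * ((F.P K).L - 1) + (F.P K).L) : ℕ) : ℝ) ^ 2 * ε₀ ^ 2 *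
              ((((F.P K).L : ℝ) ^ j) ^ 4 * ((((F.P K).L : ℝ) ^ (K - n))⁻¹) ^ 4))) := by
  set c₁ : ℝ := C2 (F.P K).d + 40000 * (((F.P K).d : ℝ) + 2) ^ 2 with hc₁def
  set δc : ℝ := (((2 * ((F.P K).d * (F.P K).L) + 1) * ((F.P K).d * ((F.P K).L - 1) + (F.P K).L) : ℕ) : ℝ) with hδcdef
  have hc₁ : 0 ≤ c₁ := by have := C1_pos (F.P K).d; rw [hc₁def]; unfold C2; positivity
  have hδc : 0 ≤ δc := Nat.cast_nonneg _
  have hℓ1 : (1 : ℝ) ≤ ((((F.P K).d + 2) * (F.P K).L : ℕ) : ℝ) := by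
    exact_mod_cast Nat.one_le_iff_ne_zero.mpr (Nat.mul_ne_zero (by omega) (by have := (F.P K).hL.2; omega))
  have hL1 : (1 : ℝ) ≤ ((F.P K).L : ℝ) := by exact_mod_cast (F.P K).L_pos
  have hrs : 240 * c₁ * δc ^ 2 * ε₀ ^ 2 ≤ 1 / 200 := rs_le_of_hw1 hℓ1 hδc hε₀.le hc₁ hw1
  have hdef := comb_eq_dbar_mul_defect_levels_inAx F hnK hε₀ hα3 hα2 hw1 hw2 hA U gJ hInAk hInAx
  have hr1 : ∀ j, j ≤ K - n →
      240 * c₁ * δc ^ 2 * ε₀ ^ 2 * ((((F.P K).L : ℝ) ^ j) ^ 4 * ((((F.P K).L : ℝ) ^ (K - n))⁻¹) ^ 4) ≤ 240 * c₁ * δc ^ 2 * ε₀ ^ 2 := by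
    intro j hj
    have h0 : 0 ≤ 240 * c₁ * δc ^ 2 * ε₀ ^ 2 := by positivity
    have := mul_le_mul_of_nonneg_left (level_ratio_pow_four_le_one hL1 hj) h0
    rwa [mul_one] at this
  exact stairSizes_of_levelDefect_inAx F hε₀ hα3 hα2 (r := fun j => 240 * c₁ * δc ^ 2 * ε₀ ^ 2 * ((((F.P K).L : ℝ) ^ j) ^ 4 * ((((F.P K).L : ℝ) ^ (K - n))⁻¹) ^ 4))
    hr1 hrs hpw hℓw U gJ hInAk hInAx hdef

/-- ★★★ **ROW (F-hU) ∕ `hStairU` FROM THE SOCKET GUARDS** — with the door's tower row `< s` on `[tlo L lo m′, thi L hi m′]` (guard (d); the door's corners are `tLo a ρ′`, `tHi a M′ ρ′`)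
and the windows `s ≤ 1∕200`, `12ℓ(s + (102∕100)·240c₁δc²ε₀²) ≤ 1`: every centre stair of `U̿^{(j)}X̂` over the level-`(j+1)` label box is a unitary matrix
(✓`stairUnitary_of_levelDefect` ∘ ✓`comb_eq_dbar_mul_defect_levels_inAx`). [cite: Balaban1987RG1, (0.4)-(0.9) p.253; Balaban1985Averaging, (89) p.31, (110) p.34, (127) p.36, Prop. 4 (134)-(135) pp.38-39; Balaban1985RegularSpaces, (1.19)-(1.20) p.79, (1.30) p.81] -/
theorem stairUnitary_of_guards_inAx (hnK : n < K) {ε₀ : ℝ} (hε₀ : 0 < ε₀)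
    (hα3 : C0 (F.P K).d * (2 * ε₀) ≤ 1 / 3) (hα2 : 2 * (2 * ε₀) ≤ c2' (F.P K).d (F.P K).L)
    (hw1 : 10 ^ 4 * ((((F.P K).d + 2) * (F.P K).L : ℕ) : ℝ) *
      ((((2 * ((F.P K).d * (F.P K).L) + 1) * ((F.P K).d * ((F.P K).L - 1) + (F.P K).L) : ℕ) : ℝ) * (4 * ε₀) +
        2 * (240 * (C2 (F.P K).d + 40000 * (((F.P K).d : ℝ) + 2) ^ 2) *
          (((2 * ((F.P K).d * (F.P K).L) + 1) * ((F.P K).d * ((F.P K).L - 1) + (F.P K).L) : ℕ) : ℝ) ^ 2 * ε₀ ^ 2)) ≤ 1)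
    (hw2 : ((F.P K).L : ℝ) * (2 * ((((2 * ((F.P K).d * (F.P K).L) + 1) * ((F.P K).d * ((F.P K).L - 1) + (F.P K).L) : ℕ) : ℝ) * (4 * ε₀))) ≤ c4 (F.P K).d)
    (hA : 33 * (2 * (((((F.P K).d + 2) * (F.P K).L : ℕ) : ℝ) + (F.P K).L + 2 * (((F.P K).d * (((F.P K).L - 1) / 2) : ℕ) : ℝ))) ≤ 20 * ((F.P K).L : ℝ) ^ 4)
    {s : ℝ} (lo hi : LSite (F.P K).d) (hs0 : 0 ≤ s) (hsw : s ≤ 1 / 200)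
    (hθw : 12 * ((((F.P K).d + 2) * (F.P K).L : ℕ) : ℝ) * (s + 102 / 100 * (240 * (C2 (F.P K).d + 40000 * (((F.P K).d : ℝ) + 2) ^ 2) *
      (((2 * ((F.P K).d * (F.P K).L) + 1) * ((F.P K).d * ((F.P K).L - 1) + (F.P K).L) : ℕ) : ℝ) ^ 2 * ε₀ ^ 2)) ≤ 1)
    (U : GaugeField (F.P K) 0 (Matrix.specialUnitaryGroup (Fin 2) ℂ)) (gJ : GaugeTransf (F.P K) 0 (Matrix.specialUnitaryGroup (Fin 2) ℂ))
    (hInAk : InAk (F.P K).L (K - n) (((F.L : ℝ)⁻¹) ^ (K - n)) ε₀ (fun _ => (Set.univ : Set (LSite (F.P K).d)))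
      (pull (unitsField (toUField (GaugeField.gaugeAct gJ U))) 0))
    (hInAx : ∀ m, m ≤ K - n → ∀ Λ : ℕ → Set (LSite (F.P K).d),
      InAx (F.P K).L m Λ (1 : LSite (F.P K).d → Fin (F.P K).d → (Matrix (Fin 2) (Fin 2) ℂ)ˣ) (pull (unitsField (toUField (GaugeField.gaugeAct gJ U))) 0))
    (htow : ∀ m', m' ≤ K - n → ∀ (x : LSite (F.P K).d) (ν : Fin (F.P K).d), tlo (F.P K).L lo m' ≤ x → x + e ν ≤ thi (F.P K).L hi m' →
      ‖((avgIter (F.P K).L (pull (unitsField (toUField (GaugeField.gaugeAct gJ U))) 0) (K - n - m') x ν : (Matrix (Fin 2) (Fin 2) ℂ)ˣ) :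
        Matrix (Fin 2) (Fin 2) ℂ) - 1‖ < s) :
    ∀ j, j < K - n → ∀ w : LSite (F.P K).d,
      InBox (tlo (F.P K).L lo (K - n - (j + 1))) (thi (F.P K).L hi (K - n - (j + 1))) w →
      ∀ i : Idx (F.P K), ((holT (dbarIterU j (unitsField (toUField (GaugeField.gaugeAct gJ U)))) (emb (coverAt (F.P K) (j + 1) w)) (stairWord i.2.1 (off i.1)) :
          (Matrix (Fin 2) (Fin 2) ℂ)ˣ) : Matrix (Fin 2) (Fin 2) ℂ) ∈ Matrix.unitaryGroup (Fin 2) ℂ := by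
  set c₁ : ℝ := C2 (F.P K).d + 40000 * (((F.P K).d : ℝ) + 2) ^ 2 with hc₁def
  set δc : ℝ := (((2 * ((F.P K).d * (F.P K).L) + 1) * ((F.P K).d * ((F.P K).L - 1) + (F.P K).L) : ℕ) : ℝ) with hδcdef
  have hc₁ : 0 ≤ c₁ := by have := C1_pos (F.P K).d; rw [hc₁def]; unfold C2; positivity
  have hδc : 0 ≤ δc := Nat.cast_nonneg _
  have hℓ1 : (1 : ℝ) ≤ ((((F.P K).d + 2) * (F.P K).L : ℕ) : ℝ) := by
    exact_mod_cast Nat.one_le_iff_ne_zero.mpr (Nat.mul_ne_zero (by omega) (by have := (F.P K).hL.2; omega))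
  have hL1 : (1 : ℝ) ≤ ((F.P K).L : ℝ) := by exact_mod_cast (F.P K).L_pos
  have hrs : 240 * c₁ * δc ^ 2 * ε₀ ^ 2 ≤ 1 / 200 := rs_le_of_hw1 hℓ1 hδc hε₀.le hc₁ hw1
  have hdef := comb_eq_dbar_mul_defect_levels_inAx F hnK hε₀ hα3 hα2 hw1 hw2 hA U gJ hInAk hInAx
  have hr1 : ∀ j, j ≤ K - n →
      240 * c₁ * δc ^ 2 * ε₀ ^ 2 * ((((F.P K).L : ℝ) ^ j) ^ 4 * ((((F.P K).L : ℝ) ^ (K - n))⁻¹) ^ 4) ≤ 240 * c₁ * δc ^ 2 * ε₀ ^ 2 := by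
    intro j hj
    have h0 : 0 ≤ 240 * c₁ * δc ^ 2 * ε₀ ^ 2 := by positivity
    have := mul_le_mul_of_nonneg_left (level_ratio_pow_four_le_one hL1 hj) h0
    rwa [mul_one] at this
  exact stairUnitary_of_levelDefect F lo hi (r := fun j => 240 * c₁ * δc ^ 2 * ε₀ ^ 2 * ((((F.P K).L : ℝ) ^ j) ^ 4 * ((((F.P K).L : ℝ) ^ (K - n))⁻¹) ^ 4))
    hs0 hsw hr1 hrs hθw U gJ htow hdef

/-- The skeleton's top box sits inside the tower row's: `tLo a ρ = a − 2ρ ≤ a − ρ = sqLo L a ρ k k` (`gs L 0 = 1`). [cite: Balaban1985RegularSpaces, p.98] (bookkeeping) -/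
theorem tLo_le_sqLo_top {d : ℕ} (L : ℕ) (a : LSite d) (ρ k : ℕ) : tLo a ρ ≤ sqLo L a ρ k k := by
  intro i
  have h0 : gs L 0 = 1 := by simp [gs]
  simp only [tLo, sqLo, bLo, Nat.sub_self, h0, mul_one, pow_zero, one_mul]
  omega

/-- … and `sqHi L a M ρ k k = a + M − 1 + ρ ≤ a + M − 1 + 2ρ = tHi a M ρ`. [cite: Balaban1985RegularSpaces, p.98] (bookkeeping) -/
theorem sqHi_top_le_tHi {d : ℕ} (L : ℕ) (a : LSite d) (M ρ k : ℕ) : sqHi L a M ρ k k ≤ tHi a M ρ := by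
  intro i
  have h0 : gs L 0 = 1 := by simp [gs]
  simp only [tHi, sqHi, bHi, Nat.sub_self, h0, mul_one, pow_zero, one_mul]
  omega

/-- ★★★ **ROW `hStairU` OF THE SKELETON `hG_of_rows`, TOKEN FOR TOKEN** (conclusion on the `sqLo∕sqHi` label boxes at `(K−n, K−n)`, tower row on `tLo a ρ′ ∕ tHi a M′ ρ′` as in the
door ✓p696030's guard (d)): `stairUnitary_of_guards_inAx` restricted by `inBox_tlo_thi_mono` ∘ `tLo_le_sqLo_top` ∘ `sqHi_top_le_tHi`.
[cite: Balaban1987RG1, (0.9) p.253; Balaban1985Averaging, (110) p.34, Prop. 4 (134)-(135) pp.38-39; Balaban1985RegularSpaces, (1.30) p.81, p.98] -/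
theorem stairUnitary_of_guards_inAx_sq (hnK : n < K) {ε₀ : ℝ} (hε₀ : 0 < ε₀)
    (hα3 : C0 (F.P K).d * (2 * ε₀) ≤ 1 / 3) (hα2 : 2 * (2 * ε₀) ≤ c2' (F.P K).d (F.P K).L)
    (hw1 : 10 ^ 4 * ((((F.P K).d + 2) * (F.P K).L : ℕ) : ℝ) *
      ((((2 * ((F.P K).d * (F.P K).L) + 1) * ((F.P K).d * ((F.P K).L - 1) + (F.P K).L) : ℕ) : ℝ) * (4 * ε₀) +
        2 * (240 * (C2 (F.P K).d + 40000 * (((F.P K).d : ℝ) + 2) ^ 2) *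
          (((2 * ((F.P K).d * (F.P K).L) + 1) * ((F.P K).d * ((F.P K).L - 1) + (F.P K).L) : ℕ) : ℝ) ^ 2 * ε₀ ^ 2)) ≤ 1)
    (hw2 : ((F.P K).L : ℝ) * (2 * ((((2 * ((F.P K).d * (F.P K).L) + 1) * ((F.P K).d * ((F.P K).L - 1) + (F.P K).L) : ℕ) : ℝ) * (4 * ε₀))) ≤ c4 (F.P K).d)
    (hA : 33 * (2 * (((((F.P K).d + 2) * (F.P K).L : ℕ) : ℝ) + (F.P K).L + 2 * (((F.P K).d * (((F.P K).L - 1) / 2) : ℕ) : ℝ))) ≤ 20 * ((F.P K).L : ℝ) ^ 4)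
    {s : ℝ} (a : LSite (F.P K).d) (M' ρ' : ℕ) (hs0 : 0 ≤ s) (hsw : s ≤ 1 / 200)
    (hθw : 12 * ((((F.P K).d + 2) * (F.P K).L : ℕ) : ℝ) * (s + 102 / 100 * (240 * (C2 (F.P K).d + 40000 * (((F.P K).d : ℝ) + 2) ^ 2) *
      (((2 * ((F.P K).d * (F.P K).L) + 1) * ((F.P K).d * ((F.P K).L - 1) + (F.P K).L) : ℕ) : ℝ) ^ 2 * ε₀ ^ 2)) ≤ 1)
    (U : GaugeField (F.P K) 0 (Matrix.specialUnitaryGroup (Fin 2) ℂ)) (gJ : GaugeTransf (F.P K) 0 (Matrix.specialUnitaryGroup (Fin 2) ℂ))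
    (hInAk : InAk (F.P K).L (K - n) (((F.L : ℝ)⁻¹) ^ (K - n)) ε₀ (fun _ => (Set.univ : Set (LSite (F.P K).d)))
      (pull (unitsField (toUField (GaugeField.gaugeAct gJ U))) 0))
    (hInAx : ∀ m, m ≤ K - n → ∀ Λ : ℕ → Set (LSite (F.P K).d),
      InAx (F.P K).L m Λ (1 : LSite (F.P K).d → Fin (F.P K).d → (Matrix (Fin 2) (Fin 2) ℂ)ˣ) (pull (unitsField (toUField (GaugeField.gaugeAct gJ U))) 0))
    (htow : ∀ m', m' ≤ K - n → ∀ (x : LSite (F.P K).d) (ν : Fin (F.P K).d), tlo (F.P K).L (tLo a ρ') m' ≤ x → x + e ν ≤ thi (F.P K).L (tHi a M' ρ') m' →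
      ‖((avgIter (F.P K).L (pull (unitsField (toUField (GaugeField.gaugeAct gJ U))) 0) (K - n - m') x ν : (Matrix (Fin 2) (Fin 2) ℂ)ˣ) :
        Matrix (Fin 2) (Fin 2) ℂ) - 1‖ < s) :
    ∀ j, j < K - n → ∀ w : LSite (F.P K).d,
      InBox (tlo (F.P K).L (sqLo (F.P K).L a ρ' (K - n) (K - n)) (K - n - (j + 1))) (thi (F.P K).L (sqHi (F.P K).L a M' ρ' (K - n) (K - n)) (K - n - (j + 1))) w →
      ∀ i : Idx (F.P K), ((holT (dbarIterU j (unitsField (toUField (GaugeField.gaugeAct gJ U)))) (emb (coverAt (F.P K) (j + 1) w)) (stairWord i.2.1 (off i.1)) :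
          (Matrix (Fin 2) (Fin 2) ℂ)ˣ) : Matrix (Fin 2) (Fin 2) ℂ) ∈ Matrix.unitaryGroup (Fin 2) ℂ :=
  fun j hj w hw i => stairUnitary_of_guards_inAx F hnK hε₀ hα3 hα2 hw1 hw2 hA (tLo a ρ') (tHi a M' ρ') hs0 hsw hθw U gJ hInAk hInAx htow j hj w
    (inBox_tlo_thi_mono (tLo_le_sqLo_top (F.P K).L a ρ' (K - n)) (sqHi_top_le_tHi (F.P K).L a M' ρ' (K - n)) _ hw) i

end Summit.QuantumFields.YangMills.Theorems.HalvingDbarStairRowsOfGuards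

end
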